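import Summits.QuantumFields.YangMills.Theorems.UnitScaleTiltProp7CornerCombCellKnitOfLe
import Summits.QuantumFields.YangMills.Theorems.UnitScaleTiltProp7CornerCombGaugeRowKernel
import HarnessLib

/-!
# Route `UnitScaleTilt`, crux K1 «MinimiserStabilityRegPr» (stmt-QuantumFields-19200), route-R E′ (A′)-on-Σ, P-A2 (β), row «(n3)-comb» `hMcomb` —
# lane (II) file F-8b-5b-0 «THE GAUGE ROW FOLDED»: ✓F-6d-3′ (Σ over corners, window-restricted) composed ONCE with ✓F-8b-5a (the gauge row kernel) — for ANY `U1`-valued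
# coordinate-periodic tower `V`, ANY coordinate-periodic family `G` with gauge recursion `Λ` (✓p717165's hypotheses verbatim, the top loop window read from a level sequence `wq`):
# `Σ_{z₀,κ}‖Λ_{k′+1}(z₀) − Ad_{V̄_{k′}} Λ_{k′+1}(z₀+e_κ)‖² ≤ Σ_{i ≤ k′} (√L)^{k′+1−i}·(Γc·GRAD_i + Μc_i·MASS_i + Δc·DEF_i)` with ✓p717111's closed coefficients and the three
# cell sums of `G` WRITTEN OUT.  SOURCE-BLIND: the sourced∕sourceless split of the comb tower enters only termwise, downstream (5b-1 for (β); px18 g5's F-9d-b for (EX)).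

Cell `ym3-torus` (HUMAN RULING D-0037: YM₃ on the torus is ladder rung R3 — not d = 4, not a mass gap, not Clay), D-0154 (3c) R3 twin-width seat `ym-routeR-w6` (gen 9);
★routeR-w1 g10 PEN-NAMER WORD 2026-08-29 12:18:49Z (F-8b-5b → routeR-w6 g9); the export as a file of its own is px18 g5's cut (12:48:47Z «the 1546-char F-6d-3′↔kernel seam
typed ONCE», my «YES» 12:54:33Z).  `--supports stmt-QuantumFields-19200 --as helper`; THEOREMS ONLY (0 `def`, 0 `sorry`); count-neutral.  «(O2) groundwork — route-internal
row (n3)-comb, NOT N06, NOT a print row; OPEN».  Nothing of `hMcomb`, `hMcomb₂`, (β), `hPA2`, `hcoS`, E′, EX, the stub, the crux, d = 4 or the gap is claimed.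

THE MATHEMATICS (Bałaban [Balaban1987RG1] (0.1)∕(0.4) pp.251–253; [Balaban1985Averaging] Prop. 3 (125)–(126) p.36).  ✓F-6d-3′
`…CellKnitOfLe.sum_cell_normSq_covGrad_gauge_le_of_le` bounds the top cell's gauge energy by TOP + COMB + O groups whose level atoms are the three cell sums
`GRAD_i = Σ_{y,μ,ν}‖Ad_{V_i(y,ν)}G_i(y+e_ν,μ) − G_i(y,μ)‖²`, `MASS_i = Σ_{y,μ}‖G_i(y,μ)‖²`, `DEF_i = Σ_{μ,y}‖G_{i+1}(y,μ) − (straight averaged step of G_i)(y,μ)‖²` over the cells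
`{boxVec (Nc i) y}`; ✓F-8b-5a `…GaugeRowKernel.gauge_row_kernel_le` says that literal right-hand side, read at ABSTRACT nonnegative level sequences `Γ Μ Δ`, is at most
`Σ_{i ∈ range (k′+1)} (√L)^{k′+1−i}·(Γc·Γ_i + Μc_i·Μ_i + Δc·Δ_i)`.  THIS FILE instantiates `Γ Μ Δ` at the written-out cell sums (opaque `∀`-form letters, `simp only` after the
kernel step) — so every consumer applies ONE theorem and does its own termwise bookkeeping.

WHAT IS PROVED (ns `…Theorems.Prop7CornerCombGaugeRowFolded`): ★★ `gauge_row_folded` — binders = ✓p717165's token for token except `{w : ℝ}` ↦ `(wq : ℕ → ℝ)` read at `wq k'`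
in `hw`∕`hw8`; conclusion = ✓p717165's left side `≤` ✓p717111's right side at its own letters `d N n A a δ wq` with `Γ i ↦ (GRAD_i)`, `Μ i ↦ (MASS_i)`, `Δ i ↦ (DEF_i)`.
HONEST SCOPE.  A composition of two landed theorems, no estimate of its own; rung R3, not Clay; YM gap NOT proved.

References: T. Bałaban, CMP **109** (1987) 249–301 [Balaban1987RG1] ((0.1), (0.4) pp.251–253); CMP **98** (1985) 17–51 [Balaban1985Averaging] ((42)–(47) pp.23–25, (112) p.34,
(125)–(126) p.36); CMP **95** (1984) 17–40 [Balaban1984PropagatorsI] ((1.18)–(1.20) pp.19–20).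
-/

set_option autoImplicit false

noncomputable section

open scoped BigOperators Matrix.Norms.L2Operator

namespace Summit.QuantumFields.YangMills.Theorems.Prop7CornerCombGaugeRowFolded

open Finset
open Literature.MathematicalPhysics.QuantumFieldTheory.Balaban1983to89
open B7Prop1Explicit (Site Letter e hol seg treeWord boxVec plaqWord U1 Wcx bavg)
open B7Eq78Linearization (conjR)
open B7Prop3GeneralLinear (FhatCov)
open Summit.QuantumFields.YangMills.Theorems.Prop7CornerCombCellKnitOfLe (sum_cell_normSq_covGrad_gauge_le_of_le)
open Summit.QuantumFields.YangMills.Theorems.Prop7CornerCombGaugeRowKernel (gauge_row_kernel_le)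

variable {d N : ℕ} [NeZero N]

/-- ★★ **THE GAUGE ROW FOLDED** — ✓F-6d-3′ ∘ ✓F-8b-5a: for a `U1`-valued coordinate-periodic tower `V`, a coordinate-periodic family `G` with gauge recursion `Λ` along
`Nc i = N′·L^{k′+1−i}`, plaquette∕bond–segment∕loop windows `a δ wq`, and the cube letters `L² + L ≤ n + 1 ≤ A·L²`, the top cell's gauge energy is at most
`Σ_{i ∈ range (k′+1)} (√L)^{k′+1−i}·(Γc·GRAD_i + Μc_i·MASS_i + Δc·DEF_i)` (coefficients = ✓p717111's, cell sums written out; see the module docstring).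
[cite: Balaban1987RG1, (0.1), (0.4) pp.251–253; Balaban1985Averaging, Prop. 3 (125)–(126) p.36] -/
theorem gauge_row_folded (L : ℕ) (hL : 2 ≤ L) (n A : ℕ) (hn : L * L + L ≤ n + 1) (hnA : n + 1 ≤ A * (L * L))
    (k' N' : ℕ) [NeZero N'] (Nc : ℕ → ℕ) (hNc : ∀ i, i ≤ k' + 1 → Nc i = N' * L ^ (k' + 1 - i))
    (V : ℕ → Site d → Fin d → (Matrix (Fin N) (Fin N) ℂ)ˣ) (hV : ∀ i, i ≤ k' → ∀ x μ, V i x μ ∈ U1 (Matrix (Fin N) (Fin N) ℂ))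
    (hVp : ∀ i, i ≤ k' → ∀ (x : Site d) (μ ι : Fin d), V i (x + ((Nc i : ℕ) : ℤ) • e ι) μ = V i x μ)
    (a : ℕ → ℝ) (ha : ∀ i, 0 ≤ a i)
    (hplaq : ∀ i, i ≤ k' → ∀ (x : Site d) (μ ν : Fin d), μ ≠ ν → ‖((hol (V i) x (plaqWord μ ν) : (Matrix (Fin N) (Fin N) ℂ)ˣ) : Matrix (Fin N) (Fin N) ℂ) - 1‖ ≤ a i)
    (δ : ℕ → ℝ) (hδ : ∀ j, 0 ≤ δ j)
    (hbs : ∀ j, j < k' → ∀ (y : Site d) (ν : Fin d), ‖((V (j + 1) y ν : (Matrix (Fin N) (Fin N) ℂ)ˣ) : Matrix (Fin N) (Fin N) ℂ)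
      - ((hol (V j) ((L : ℤ) • y) (seg ν (L : ℤ)) : (Matrix (Fin N) (Fin N) ℂ)ˣ) : Matrix (Fin N) (Fin N) ℂ)‖ ≤ δ j)
    (wq : ℕ → ℝ)
    (hw : ∀ (z₀ : Fin d → Fin N') (κ : Fin d) (r : Fin d → Fin L),
      ‖((Wcx L (V k') ((L : ℤ) • boxVec N' z₀) κ (boxVec L r) : (Matrix (Fin N) (Fin N) ℂ)ˣ) : Matrix (Fin N) (Fin N) ℂ) - 1‖ ≤ wq k') (hw8 : wq k' ≤ 1 / 8)
    (hbU : ∀ (z₀ : Fin d → Fin N') (κ : Fin d), bavg L (V k') ((L : ℤ) • boxVec N' z₀) κ ∈ U1 (Matrix (Fin N) (Fin N) ℂ))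
    (G : ℕ → Site d → Fin d → Matrix (Fin N) (Fin N) ℂ)
    (hGp : ∀ i, i ≤ k' → ∀ (x : Site d) (μ ι : Fin d), G i (x + ((Nc i : ℕ) : ℤ) • e ι) μ = G i x μ)
    (Λ : ℕ → Site d → Matrix (Fin N) (Fin N) ℂ) (hΛ0 : ∀ y, Λ 0 y = 0)
    (hΛs : ∀ i, i ≤ k' → ∀ y : Site d, Λ (i + 1) y = FhatCov L (V i) (G i) ((L : ℤ) • y) + Λ i ((L : ℤ) • y)) :
    ∑ z₀ : Fin d → Fin N', ∑ κ : Fin d,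
        ‖Λ (k' + 1) (boxVec N' z₀) - conjR (bavg L (V k') ((L : ℤ) • boxVec N' z₀) κ) (Λ (k' + 1) (boxVec N' z₀ + e κ))‖ ^ 2
      ≤ ∑ i ∈ Finset.range (k' + 1), (Real.sqrt L) ^ (k' + 1 - i) *
          (3 * ((Real.sqrt L)⁻¹ * ((d : ℝ) * ((L : ℝ) ^ 2 / 4) * (2 * ((L : ℝ) ^ d)⁻¹ * (L : ℝ) * (L : ℝ)))
              + (L : ℝ)⁻¹ * (2 * (d : ℝ) * (1 - (Real.sqrt L)⁻¹)⁻¹ * ((L : ℝ) ^ 2 / 4) * 2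
                  * (((L : ℝ) ^ d)⁻¹ * (3 * N * ((n : ℝ) + 1) ^ 2 * ((d : ℝ) * ((d : ℝ) * (A : ℝ) ^ d)))))
              + (Real.sqrt L)⁻¹ * (2 * (1 - (Real.sqrt L)⁻¹)⁻¹ * 2 * (N / 2 * (d : ℝ) ^ 2 * ((L : ℝ) - 1) ^ 2 * (L : ℝ) ^ 2 * (d : ℝ))))
            * (∑ y : Fin d → Fin (Nc i), ∑ μ : Fin d, ∑ ν : Fin d,
              ‖conjR (V i (boxVec (Nc i) y) ν) (G i (boxVec (Nc i) y + e ν) μ) - G i (boxVec (Nc i) y) μ‖ ^ 2)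
          + 3 * ((Real.sqrt L)⁻¹ * ((d : ℝ) * ((L : ℝ) ^ 2 / 4) * (2 * ((L : ℝ) ^ d)⁻¹ * (8 * (((d : ℝ) + 1) * (L : ℝ)) ^ 2 * a i + 8 * wq i) ^ 2 * (d : ℝ)))
              + (L : ℝ)⁻¹ * (2 * (d : ℝ) * (1 - (Real.sqrt L)⁻¹)⁻¹ * ((L : ℝ) ^ 2 / 4) * 2
                  * (((L : ℝ) ^ d)⁻¹ * ((12 * N * ((n : ℝ) + 1) ^ 2 * (d : ℝ) ^ 3 * (n : ℝ) ^ 2 * a i ^ 2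
                      + 3 * (2 * d * L * δ i + 2 * ((3 * d + 1) * n : ℝ) ^ 2 * a i) ^ 2) * ((d : ℝ) * ((d : ℝ) * (A : ℝ) ^ d)))))
              + (Real.sqrt L)⁻¹ * (2 * (1 - (Real.sqrt L)⁻¹)⁻¹ * 2
                  * ((8 * (d : ℝ) ^ 6 * ((L : ℝ) - 1) ^ 6 + 2 * N * (d : ℝ) ^ 5 * ((L : ℝ) - 1) ^ 4 * (L : ℝ) ^ 2) * a i ^ 2 * (d : ℝ))))
            * (∑ y : Fin d → Fin (Nc i), ∑ μ : Fin d, ‖G i (boxVec (Nc i) y) μ‖ ^ 2)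
          + 3 * ((L : ℝ)⁻¹ * (2 * (d : ℝ) * (1 - (Real.sqrt L)⁻¹)⁻¹ * ((L : ℝ) ^ 2 / 4) * 2 * (3 * ((L : ℝ) ^ 2)⁻¹ * ((L : ℝ) ^ d)⁻¹ * (d : ℝ))))
            * (∑ μ : Fin d, ∑ y : Fin d → Fin (Nc (i + 1)),
              ‖G (i + 1) (boxVec (Nc (i + 1)) y) μ
                - ∑ r : Fin d → Fin L, ∑ t ∈ Finset.range L, (((L : ℝ) ^ d)⁻¹) •
                    conjR (hol (V i) ((L : ℤ) • boxVec (Nc (i + 1)) y) (treeWord (boxVec L r) ++ seg μ (t : ℤ)))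
                      (G i ((L : ℤ) • boxVec (Nc (i + 1)) y + boxVec L r + (t : ℤ) • e μ) μ)‖ ^ 2)) := by
  -- the three cell energies as opaque letters
  obtain ⟨Γ, hΓ⟩ : ∃ Γ : ℕ → ℝ, ∀ i, Γ i = ∑ y : Fin d → Fin (Nc i), ∑ μ : Fin d, ∑ ν : Fin d,
      ‖conjR (V i (boxVec (Nc i) y) ν) (G i (boxVec (Nc i) y + e ν) μ) - G i (boxVec (Nc i) y) μ‖ ^ 2 := ⟨_, fun _ => rfl⟩
  obtain ⟨Μ, hΜ⟩ : ∃ Μ : ℕ → ℝ, ∀ i, Μ i = ∑ y : Fin d → Fin (Nc i), ∑ μ : Fin d, ‖G i (boxVec (Nc i) y) μ‖ ^ 2 := ⟨_, fun _ => rfl⟩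
  obtain ⟨Δ, hΔ⟩ : ∃ Δ : ℕ → ℝ, ∀ i, Δ i = ∑ μ : Fin d, ∑ y : Fin d → Fin (Nc (i + 1)),
      ‖G (i + 1) (boxVec (Nc (i + 1)) y) μ
        - ∑ r : Fin d → Fin L, ∑ t ∈ Finset.range L, (((L : ℝ) ^ d)⁻¹) •
            conjR (hol (V i) ((L : ℤ) • boxVec (Nc (i + 1)) y) (treeWord (boxVec L r) ++ seg μ (t : ℤ)))
              (G i ((L : ℤ) • boxVec (Nc (i + 1)) y + boxVec L r + (t : ℤ) • e μ) μ)‖ ^ 2 := ⟨_, fun _ => rfl⟩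
  have hΓ0 : ∀ i, 0 ≤ Γ i := fun i => by rw [hΓ]; positivity
  have hΜ0 : ∀ i, 0 ≤ Μ i := fun i => by rw [hΜ]; positivity
  have hΔ0 : ∀ i, 0 ≤ Δ i := fun i => by rw [hΔ]; positivity
  -- ✓F-6d-3′ (Σ over corners, restricted), then ✓F-8b-5a (the kernel) at the letters, unfolded on its left side only after the fact
  have h6 := sum_cell_normSq_covGrad_gauge_le_of_le L hL n A hn hnA k' N' Nc hNc V hV hVp a ha hplaq δ hδ hbs hw hw8 hbU G hGp Λ hΛ0 hΛs
  have hker := gauge_row_kernel_le L hL d N n A k' a δ Γ Μ Δ wq ha hΓ0 hΜ0 hΔ0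
  simp only [hΓ, hΜ, hΔ] at hker
  exact h6.trans hker

end Summit.QuantumFields.YangMills.Theorems.Prop7CornerCombGaugeRowFolded

end
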